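import Literature.NumberTheory.ConnesMoscovici2022.UVProlateInhomogeneousToolkit
import Mathlib.Analysis.SpecialFunctions.ImproperIntegrals
import Mathlib.MeasureTheory.Integral.IntegralEqImproper

/-!
# Connes–Moscovici 2022, §1: asymptotics at `+∞` of GENERAL elements of `dom W_max`

LINE 1 — FRAMING. RH-FREE corpus literature (cell rh-crit, C1 Connes–Consani/Moscovici corpus,
row O2 `UVProlateSpectrum`: the self-adjointness theory of the prolate wave operator
`W_λ = −∂ₓ(λ² − x²)∂ₓ + (2πλx)²`; sequel material with no leaf / binder role in any route).
bears_on: LADDER-RH W-C/W-P.  WHAT THIS IS NOT: any claim about `ζ` or RH; nothing here bears on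
the truth of RH.  Theorems only: 0 `def`s, 0 named facts, no `sorry`.

## Source and purpose

A. Connes, H. Moscovici, *The UV prolate spectrum matches the zeros of zeta*, PNAS 119 (2022)
[ConnesMoscovici2022] = arXiv:2112.05500, §1 (= arXiv §2): the boundary conditions (1.20)/(1.21)
at `±∞` defining `dom W_sa` (held text `paper-arxiv-2112.05500`, chunk p0006:L62–L69) and
Cor 1.7 (ii) ("the leading term of the asymptotic expansion of `φ` at `∞` is proportional to
`sin(2πλx)/x` if `φ` is even and to `cos(2πλx)/x` if `φ` is odd", chunk p0006:L121–L123).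

The tree proves these asymptotics for EIGENFUNCTIONS (`UVProlateEigenfunctionAsymptotics`, seat
cc-t14 g2: classical ODE `(p g′)′ = (q − μ) g`, `g ∈ C^∞`).  The symmetry / self-adjointness of
`W_sa` ([ConnesMoscovici2022, Thm 1.6 (i)]) needs the same control for a GENERAL `ξ ∈ dom W_max`,
whose regular representative `g` (seat cc-t6, `UVProlateMaxDomainRegularity.exists_regular_repr`)
is only `C¹` off `±λ` with `p g′` a primitive of `q g − η`, `η = W_max ξ ∈ L²` ARBITRARY.  This
file proves, in exactly that "FTC shape" and with no boundary condition assumed: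

* §1 `exists_tendsto_pair_of_ftc` — abstract engine: two continuous functions `α, β` on
  `(x₀, ∞)` with `α(y) − α(x) = ∫_x^y a`, `β(y) − β(x) = ∫_x^y b`,
  `‖a‖, ‖b‖ ≤ c(‖α‖ + ‖β‖) + h`, `c, h ≥ 0` integrable ⇒ both converge at `+∞` (a small tail of
  `∫ c` bounds the running supremum; no Gronwall, no derivatives).
* §3 **`exists_asymptotics_atTop_of_ftc`** — for `g ∈ C¹(x₀, ∞)` with
  `p(y)g′(y) − p(x)g′(x) = ∫_x^y (q g − η)` and `η ∈ L²(x₀, ∞)`: there are `A, B ∈ ℂ` with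
  `x g(x) − (A sin(2πλx) + B cos(2πλx)) → 0` and
  `(g + x g′)(x) − 2πλ (A cos(2πλx) − B sin(2πλx)) → 0` — every element of `dom W_max` oscillates
  like `(A sin + B cos)(2πλx)/x` at `+∞`.  Mechanism: `v = xg`, `v₁ = g + xg′` with
  `v₁(y) − v₁(x) = ∫ V₂` (integration by parts against the primitive `p g′`,
  `intervalIntegral_mul_eq_of_primitive`), osculating constants
  `α = cos(ωx)v − sin(ωx)v₁/ω`, `β = sin(ωx)v + cos(ωx)v₁/ω` (`ω = 2πλ`) with
  `α′ = −(sin/ω)R`, `β′ = (cos/ω)R` in FTC form, `R = 2λ²(pg′)/p² + ω²λ²v/p − xη/p`,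
  `|R| ≤ c(|α| + |β|) + (2/3)(|η|² + x⁻²)`, `c = O(x⁻²)`.
* §4 `tendsto_bcInfEven_of_asymptotics` / `tendsto_bcInfOdd_of_asymptotics` — along these
  asymptotics the printed boundary expressions converge: `bcInfEven λ g → −2πλ·B`,
  `bcInfOdd λ g → 2πλ·A`; so (1.20) at `+∞` ⇔ `B = 0` and (1.21) ⇔ `A = 0`.

Consumer: seat cc-t6's `UVProlateSymmetryAtInfinity` (the `±∞` boundary form in the Green
identity for two elements of `𝓛_β` tends to `0`), i.e. the symmetric half of Thm 1.6 (i).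
Cell rh-crit seat cc-t14 g3.
-/

noncomputable section

open Complex Set MeasureTheory Filter Topology intervalIntegral
open scoped Real Topology

namespace Literature.NumberTheory.ConnesMoscovici2022

/-! ## §1. Osculating constants in FTC form: boundedness and convergence (abstract) -/

section Osculating

/-- **Abstract convergence lemma for a pair of osculating constants in FTC form.**  Let `α, β`
be continuous on `(x₀, ∞)` with `α(y) − α(x) = ∫_x^y a`, `β(y) − β(x) = ∫_x^y b`, where
`‖a‖, ‖b‖ ≤ c·(‖α‖ + ‖β‖) + h` with `c, h ≥ 0` integrable on `(x₀, ∞)`.  Then `‖α‖ + ‖β‖` is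
bounded (a small tail of `∫ c` bounds the running supremum — no Gronwall needed), `a, b` are
integrable at `+∞`, and `α`, `β` converge.  (Variation of constants for `v″ + w²v = R`,
`|R| ≤ c(|v| + |v′|) + h`, written without second derivatives.)
[cite: ConnesMoscovici2022, Cor 1.7 (ii) and (1.20)–(1.21) (= arXiv:2112.05500 Cor 2.7 (ii), chunk p0006:L121–L123; (2.20)–(2.21), chunk p0006:L62–L69)] -/
theorem exists_tendsto_pair_of_ftc {x₀ : ℝ} {α β a b : ℝ → ℂ} {c h : ℝ → ℝ}
    (hαc : ContinuousOn α (Ioi x₀)) (hβc : ContinuousOn β (Ioi x₀))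
    (hαF : ∀ x y, x₀ < x → x ≤ y → α y - α x = ∫ t in x..y, a t)
    (hβF : ∀ x y, x₀ < x → x ≤ y → β y - β x = ∫ t in x..y, b t)
    (ham : AEStronglyMeasurable a (volume.restrict (Ioi x₀)))
    (hbm : AEStronglyMeasurable b (volume.restrict (Ioi x₀)))
    (hc0 : ∀ x ∈ Ioi x₀, 0 ≤ c x) (hcint : IntegrableOn c (Ioi x₀))
    (hh0 : ∀ x ∈ Ioi x₀, 0 ≤ h x) (hhint : IntegrableOn h (Ioi x₀))
    (hale : ∀ x ∈ Ioi x₀, ‖a x‖ ≤ c x * (‖α x‖ + ‖β x‖) + h x)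
    (hble : ∀ x ∈ Ioi x₀, ‖b x‖ ≤ c x * (‖α x‖ + ‖β x‖) + h x) :
    (∃ A : ℂ, Tendsto α atTop (𝓝 A)) ∧ ∃ B : ℂ, Tendsto β atTop (𝓝 B) := by
  -- a point `x₁` beyond which the tail of `∫ c` is `≤ 1/4`
  set I : ℝ := ∫ t in Ioi x₀, c t with hI
  have hT : Tendsto (fun X ↦ ∫ t in x₀..X, c t) atTop (𝓝 I) :=
    intervalIntegral_tendsto_integral_Ioi x₀ hcint tendsto_id
  have htail : ∀ X, x₀ ≤ X → ∫ t in Ioi X, c t = I - ∫ t in x₀..X, c t := by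
    intro X hX
    rw [hI, intervalIntegral.integral_of_le hX, ← Ioc_union_Ioi_eq_Ioi hX,
      setIntegral_union (Set.disjoint_left.2 fun t (ht : t ∈ Ioc x₀ X) (ht' : t ∈ Ioi X) ↦
          (not_lt.2 ht.2) ht') measurableSet_Ioi
        (hcint.mono_set Ioc_subset_Ioi_self) (hcint.mono_set (Ioi_subset_Ioi hX))]
    ring
  have htail0 : Tendsto (fun X ↦ ∫ t in Ioi X, c t) atTop (𝓝 0) := by
    have h := (tendsto_const_nhds (x := I)).sub hT
    rw [sub_self] at h
    refine h.congr' ?_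
    filter_upwards [eventually_ge_atTop x₀] with X hX
    exact (htail X hX).symm
  obtain ⟨N₂, hN₂⟩ : ∃ N, ∀ X ≥ N, ∫ t in Ioi X, c t ≤ 1 / 4 :=
    eventually_atTop.1 (htail0.eventually (ge_mem_nhds (by norm_num : (0:ℝ) < 1 / 4)))
  set x₁ : ℝ := max N₂ (x₀ + 1) with hx₁
  have hx₁₀ : x₀ < x₁ := lt_of_lt_of_le (lt_add_one x₀) (le_max_right _ _)
  have hx₁N₂ : N₂ ≤ x₁ := le_max_left _ _
  have hsub₁ : Ioi x₁ ⊆ Ioi x₀ := Ioi_subset_Ioi hx₁₀.le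
  have htail₁ : ∫ t in Ioi x₁, c t ≤ 1 / 4 := hN₂ x₁ hx₁N₂
  have hct_sub : ∀ x y, x₁ ≤ x → x ≤ y → ∫ t in x..y, c t ≤ 1 / 4 := by
    intro x y hx hxy
    rw [intervalIntegral.integral_of_le hxy]
    refine le_trans ?_ htail₁
    refine setIntegral_mono_set (hcint.mono_set hsub₁) ?_ (ae_of_all _ fun t ht ↦ ?_)
    · rw [EventuallyLE, ae_restrict_iff' measurableSet_Ioi]
      exact ae_of_all _ fun t ht ↦ hc0 t (hsub₁ ht)
    · exact lt_of_le_of_lt hx ht.1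
  -- `H = ∫_{x₁}^∞ h` bounds all partial integrals of `h`
  set H : ℝ := ∫ t in Ioi x₁, h t with hH
  have hH0 : 0 ≤ H := setIntegral_nonneg measurableSet_Ioi fun t ht ↦ hh0 t (hsub₁ ht)
  have hh_sub : ∀ x y, x₁ ≤ x → x ≤ y → ∫ t in x..y, h t ≤ H := by
    intro x y hx hxy
    rw [intervalIntegral.integral_of_le hxy, hH]
    refine setIntegral_mono_set (hhint.mono_set hsub₁) ?_ (ae_of_all _ fun t ht ↦ ?_)
    · rw [EventuallyLE, ae_restrict_iff' measurableSet_Ioi]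
      exact ae_of_all _ fun t ht ↦ hh0 t (hsub₁ ht)
    · exact lt_of_le_of_lt hx ht.1
  -- interval integrability of `c` and `h` beyond `x₁`
  have hci : ∀ x y, x₁ ≤ x → x ≤ y → IntervalIntegrable c volume x y := by
    intro x y hx hxy
    have hs : Ioc x y ⊆ Ioi x₀ := fun t ht ↦ lt_trans hx₁₀ (lt_of_le_of_lt hx ht.1)
    rw [intervalIntegrable_iff_integrableOn_Ioc_of_le hxy]
    exact hcint.mono_set hs
  have hhi : ∀ x y, x₁ ≤ x → x ≤ y → IntervalIntegrable h volume x y := by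
    intro x y hx hxy
    have hs : Ioc x y ⊆ Ioi x₀ := fun t ht ↦ lt_trans hx₁₀ (lt_of_le_of_lt hx ht.1)
    rw [intervalIntegrable_iff_integrableOn_Ioc_of_le hxy]
    exact hhint.mono_set hs
  -- uniform bound on `‖α‖ + ‖β‖` beyond `x₁`
  set γ : ℝ → ℝ := fun t ↦ ‖α t‖ + ‖β t‖ with hγ
  have hγc : ContinuousOn γ (Ioi x₀) := hαc.norm.add hβc.norm
  set S₀ : ℝ := 2 * γ x₁ + 4 * H with hS₀
  have hγbound : ∀ X, x₁ ≤ X → γ X ≤ S₀ := by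
    intro X hX
    obtain ⟨xs, hxs, hmax⟩ := (isCompact_Icc (a := x₁) (b := X)).exists_isMaxOn
      (nonempty_Icc.2 hX) (hγc.mono fun t ht ↦ lt_of_lt_of_le hx₁₀ ht.1)
    set S : ℝ := γ xs with hS
    have hSle : ∀ x ∈ Icc x₁ X, γ x ≤ S := fun x hx ↦ hmax hx
    have hS0 : 0 ≤ S := le_trans (by positivity) (hSle x₁ (left_mem_Icc.2 hX))
    -- one-step estimate for `α` and for `β`
    have hstep : ∀ {φ ψ : ℝ → ℂ}, (∀ x y, x₀ < x → x ≤ y → φ y - φ x = ∫ t in x..y, ψ t) →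
        (∀ x ∈ Ioi x₀, ‖ψ x‖ ≤ c x * (‖α x‖ + ‖β x‖) + h x) →
        ∀ x ∈ Icc x₁ X, ‖φ x‖ ≤ ‖φ x₁‖ + (S * (1 / 4) + H) := by
      intro φ ψ hF hle x hx
      have h1 : ‖φ x - φ x₁‖ ≤ ∫ t in x₁..x, (c t * S + h t) := by
        rw [hF x₁ x hx₁₀ hx.1]
        refine intervalIntegral.norm_integral_le_of_norm_le hx.1 (ae_of_all _ fun t ht ↦ ?_)
          (((hci x₁ x le_rfl hx.1).mul_const S).add (hhi x₁ x le_rfl hx.1))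
        have ht₀ : t ∈ Ioi x₀ := lt_trans hx₁₀ ht.1
        calc ‖ψ t‖ ≤ c t * (‖α t‖ + ‖β t‖) + h t := hle t ht₀
          _ ≤ c t * S + h t := by
            gcongr
            · exact hc0 t ht₀
            · exact hSle t ⟨ht.1.le, ht.2.trans hx.2⟩
      have h2 : ∫ t in x₁..x, (c t * S + h t) ≤ 1 / 4 * S + H := by
        rw [intervalIntegral.integral_add ((hci x₁ x le_rfl hx.1).mul_const S)
          (hhi x₁ x le_rfl hx.1), intervalIntegral.integral_mul_const]
        exact add_le_add (mul_le_mul_of_nonneg_right (hct_sub x₁ x le_rfl hx.1) hS0)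
          (hh_sub x₁ x le_rfl hx.1)
      calc ‖φ x‖ = ‖φ x₁ + (φ x - φ x₁)‖ := by ring_nf
        _ ≤ ‖φ x₁‖ + ‖φ x - φ x₁‖ := norm_add_le _ _
        _ ≤ ‖φ x₁‖ + (S * (1 / 4) + H) := by linarith
    have hkey : ∀ x ∈ Icc x₁ X, γ x ≤ γ x₁ + (S * (1 / 2) + 2 * H) := by
      intro x hx
      have ha := hstep hαF hale x hx
      have hb := hstep hβF hble x hx
      simp only [hγ] at ha hb ⊢
      linarith
    have hSbound : S ≤ S₀ := by
      have := hkey xs hxs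
      rw [← hS] at this
      rw [hS₀]; linarith
    exact (hSle X (right_mem_Icc.2 hX)).trans hSbound
  -- `a`, `b` are integrable on `(x₁, ∞)`
  have hint : ∀ {ψ : ℝ → ℂ}, AEStronglyMeasurable ψ (volume.restrict (Ioi x₀)) →
      (∀ x ∈ Ioi x₀, ‖ψ x‖ ≤ c x * (‖α x‖ + ‖β x‖) + h x) → IntegrableOn ψ (Ioi x₁) := by
    intro ψ hψm hle
    refine Integrable.mono' (((hcint.mono_set hsub₁).mul_const S₀).add (hhint.mono_set hsub₁))
      (hψm.mono_set hsub₁) ?_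
    rw [ae_restrict_iff' measurableSet_Ioi]
    refine ae_of_all _ fun t ht ↦ ?_
    have ht₀ : t ∈ Ioi x₀ := hsub₁ ht
    calc ‖ψ t‖ ≤ c t * (‖α t‖ + ‖β t‖) + h t := hle t ht₀
      _ ≤ c t * S₀ + h t := by
        gcongr
        · exact hc0 t ht₀
        · exact hγbound t (le_of_lt ht)
  -- conclusion
  have hconv : ∀ {φ ψ : ℝ → ℂ}, (∀ x y, x₀ < x → x ≤ y → φ y - φ x = ∫ t in x..y, ψ t) →
      IntegrableOn ψ (Ioi x₁) → ∃ A : ℂ, Tendsto φ atTop (𝓝 A) := by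
    intro φ ψ hF hψ
    refine ⟨φ x₁ + ∫ t in Ioi x₁, ψ t, ?_⟩
    have hlim : Tendsto (fun X ↦ φ x₁ + ∫ t in x₁..X, ψ t) atTop
        (𝓝 (φ x₁ + ∫ t in Ioi x₁, ψ t)) :=
      tendsto_const_nhds.add (intervalIntegral_tendsto_integral_Ioi x₁ hψ tendsto_id)
    refine hlim.congr' ?_
    filter_upwards [eventually_ge_atTop x₁] with X hX
    have := hF x₁ X hx₁₀ hX
    linear_combination -this
  exact ⟨hconv hαF (hint ham hale), hconv hβF (hint hbm hble)⟩

end Osculating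

/-! ## §2. Trigonometric plumbing -/

section Trig

/-- `cos² + sin² = 1`, complexified. [folklore] -/
private theorem cos_sq_add_sin_sq_ofReal (t : ℝ) :
    ((Real.cos t : ℝ) : ℂ) ^ 2 + ((Real.sin t : ℝ) : ℂ) ^ 2 = 1 := by
  exact_mod_cast Real.cos_sq_add_sin_sq t

/-- Reconstruction `v = cos θ · α + sin θ · β`. [folklore] -/
private theorem osc_reconstruct {w : ℝ} (hw : w ≠ 0) (t : ℝ) (v v' : ℂ) :
    ((Real.cos t : ℝ) : ℂ) * ((Real.cos t : ℂ) * v - (Real.sin t : ℂ) * v' / w) +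
      ((Real.sin t : ℝ) : ℂ) * ((Real.sin t : ℂ) * v + (Real.cos t : ℂ) * v' / w) = v := by
  have h := cos_sq_add_sin_sq_ofReal t
  have hw' : (w : ℂ) ≠ 0 := Complex.ofReal_ne_zero.2 hw
  field_simp
  linear_combination v * (w : ℂ) * h

/-- Reconstruction `v′ = w (−sin θ · α + cos θ · β)`. [folklore] -/
private theorem osc_reconstruct_deriv {w : ℝ} (hw : w ≠ 0) (t : ℝ) (v v' : ℂ) :
    (w : ℂ) * (-((Real.sin t : ℝ) : ℂ) * ((Real.cos t : ℂ) * v - (Real.sin t : ℂ) * v' / w) +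
      ((Real.cos t : ℝ) : ℂ) * ((Real.sin t : ℂ) * v + (Real.cos t : ℂ) * v' / w)) = v' := by
  have h := cos_sq_add_sin_sq_ofReal t
  have hw' : (w : ℂ) ≠ 0 := Complex.ofReal_ne_zero.2 hw
  field_simp
  linear_combination v' * h

/-- `‖cos θ · z‖ ≤ ‖z‖`. [folklore] -/
private theorem norm_cos_mul_le (t : ℝ) (z : ℂ) : ‖((Real.cos t : ℝ) : ℂ) * z‖ ≤ ‖z‖ := by
  rw [norm_mul]
  refine mul_le_of_le_one_left (norm_nonneg _) ?_
  rw [Complex.norm_real, Real.norm_eq_abs]; exact Real.abs_cos_le_one t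

/-- `‖sin θ · z‖ ≤ ‖z‖`. [folklore] -/
private theorem norm_sin_mul_le (t : ℝ) (z : ℂ) : ‖((Real.sin t : ℝ) : ℂ) * z‖ ≤ ‖z‖ := by
  rw [norm_mul]
  refine mul_le_of_le_one_left (norm_nonneg _) ?_
  rw [Complex.norm_real, Real.norm_eq_abs]; exact Real.abs_sin_le_one t

/-- `‖v‖ ≤ ‖α‖ + ‖β‖`. [folklore] -/
private theorem norm_le_osc {w : ℝ} (hw : w ≠ 0) (t : ℝ) (v v' : ℂ) :
    ‖v‖ ≤ ‖(Real.cos t : ℂ) * v - (Real.sin t : ℂ) * v' / w‖ +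
      ‖(Real.sin t : ℂ) * v + (Real.cos t : ℂ) * v' / w‖ := by
  conv_lhs => rw [← osc_reconstruct hw t v v']
  exact (norm_add_le _ _).trans (add_le_add (norm_cos_mul_le _ _) (norm_sin_mul_le _ _))

/-- `‖v′‖ ≤ |w| (‖α‖ + ‖β‖)`. [folklore] -/
private theorem norm_deriv_le_osc {w : ℝ} (hw : w ≠ 0) (t : ℝ) (v v' : ℂ) :
    ‖v'‖ ≤ |w| * (‖(Real.cos t : ℂ) * v - (Real.sin t : ℂ) * v' / w‖ +
      ‖(Real.sin t : ℂ) * v + (Real.cos t : ℂ) * v' / w‖) := by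
  conv_lhs => rw [← osc_reconstruct_deriv hw t v v']
  rw [norm_mul, Complex.norm_real, Real.norm_eq_abs]
  refine mul_le_mul_of_nonneg_left ((norm_add_le _ _).trans (add_le_add ?_ ?_)) (abs_nonneg _)
  · rw [neg_mul, norm_neg]; exact norm_sin_mul_le _ _
  · exact norm_cos_mul_le _ _

/-- `d/dt sin(wt) = w cos(wt)`, complexified. [folklore] -/
private theorem hasDerivAt_sin_ofReal (w t : ℝ) :
    HasDerivAt (fun s : ℝ ↦ ((Real.sin (w * s) : ℝ) : ℂ)) (((w * Real.cos (w * t) : ℝ) : ℂ)) t := by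
  have h0 : HasDerivAt (fun s : ℝ ↦ w * s) w t := by simpa using (hasDerivAt_id t).const_mul w
  have h : HasDerivAt (fun s : ℝ ↦ Real.sin (w * s)) (w * Real.cos (w * t)) t :=
    h0.sin.congr_deriv (by ring)
  exact h.ofReal_comp

/-- `d/dt cos(wt) = −w sin(wt)`, complexified. [folklore] -/
private theorem hasDerivAt_cos_ofReal (w t : ℝ) :
    HasDerivAt (fun s : ℝ ↦ ((Real.cos (w * s) : ℝ) : ℂ)) (((-(w * Real.sin (w * t)) : ℝ) : ℂ)) t := by
  have h0 : HasDerivAt (fun s : ℝ ↦ w * s) w t := by simpa using (hasDerivAt_id t).const_mul w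
  have h : HasDerivAt (fun s : ℝ ↦ Real.cos (w * s)) (-(w * Real.sin (w * t))) t :=
    h0.cos.congr_deriv (by ring)
  exact h.ofReal_comp

/-- `c/w · (V + w² v) = c/w · V + w c v` (`w ≠ 0`). [folklore] -/
private theorem div_mul_add_sq {w : ℂ} (hw : w ≠ 0) (c V v : ℂ) :
    c / w * (V + w ^ 2 * v) = c / w * V + w * c * v := by
  have : c / w * (w ^ 2 * v) = w * c * v := by
    rw [pow_two, ← mul_assoc, ← mul_assoc, div_mul_cancel₀ c hw]; ring
  rw [mul_add, this]

end Trig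

/-! ## §3. The prolate equation at `+∞` in FTC form: asymptotics of a general solution -/

section Prolate

variable {lam : ℝ}

/-- `p(x) = λ² − x²` has derivative `−2x`. [folklore] -/
private theorem hasDerivAt_pCoeff₂ (lam x : ℝ) :
    HasDerivAt (pCoeff lam) (((-(2 * x) : ℝ) : ℂ)) x := by
  have h : HasDerivAt (fun y : ℝ ↦ lam ^ 2 - y ^ 2) (-(2 * x)) x := by
    simpa using (hasDerivAt_pow 2 x).const_sub (lam ^ 2)
  have e : pCoeff lam = fun y : ℝ ↦ (((lam ^ 2 - y ^ 2 : ℝ)) : ℂ) := rfl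
  rw [e]
  exact h.ofReal_comp

/-- `p` is continuous. [folklore] -/
private theorem continuous_pCoeff₂ (lam : ℝ) : Continuous (pCoeff lam) := by
  have e : pCoeff lam = fun y : ℝ ↦ (((lam ^ 2 - y ^ 2 : ℝ)) : ℂ) := rfl
  rw [e]; fun_prop

/-- `q` is continuous. [folklore] -/
private theorem continuous_qCoeff₂ (lam : ℝ) : Continuous (qCoeff lam) := by
  have e : qCoeff lam = fun y : ℝ ↦ ((((2 * π * lam) ^ 2 * y ^ 2 : ℝ)) : ℂ) := rfl
  rw [e]; fun_prop

/-- `‖p(t)‖ = t² − λ²` and the two-sided comparison with `t²` for `t ≥ 2λ > 0`. [folklore] -/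
private theorem norm_pCoeff_bounds (hlam : 0 < lam) {t : ℝ} (ht : 2 * lam ≤ t) :
    ‖pCoeff lam t‖ = t ^ 2 - lam ^ 2 ∧ 3 / 4 * t ^ 2 ≤ ‖pCoeff lam t‖ ∧ ‖pCoeff lam t‖ ≤ t ^ 2 := by
  have h1 : ‖pCoeff lam t‖ = t ^ 2 - lam ^ 2 := by
    rw [pCoeff, Complex.norm_real, Real.norm_eq_abs, abs_of_nonpos (by nlinarith)]
    ring
  refine ⟨h1, ?_, ?_⟩ <;> rw [h1] <;> nlinarith

/-- **Asymptotics at `+∞`, technical form** (`x₀ ≥ max(2λ, 1)`; see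
`exists_asymptotics_atTop_of_ftc` for the exported statement).  Let `g ∈ C¹(x₀, ∞)` (`x₀ ≥ max(2λ, 1)`) with `p g′` a primitive of
`q g − η` on `(x₀, ∞)` — the shape of `UVProlateMaxDomainRegularity.exists_regular_repr` for
`ξ ∈ dom W_max`, `η = W_max ξ` — and `η ∈ L²(x₀, ∞)`.  Then for some `A, B ∈ ℂ`
  `x g(x) − (A sin(2πλx) + B cos(2πλx)) → 0` and `(g + x g′)(x) − 2πλ (A cos(2πλx) − B sin(2πλx)) → 0`
as `x → +∞`: every element of `dom W_max` oscillates like `(A sin + B cos)(2πλx)/x` at `+∞`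
(the boundary conditions (1.20)/(1.21) then select `B = 0` on even, `A = 0` on odd parts, cf.
`tendsto_bcInfEven_of_asymptotics`).  Mechanism: with `v = xg`, `v₁ = g + xg′` (so
`v₁(y) − v₁(x) = ∫ V₂` in FTC form, by integration by parts against the primitive `p g′`), the
osculating constants `α = cos(ωx)v − sin(ωx)v₁/ω`, `β = sin(ωx)v + cos(ωx)v₁/ω` satisfy
`α′ = −(sin/ω)R`, `β′ = (cos/ω)R` in FTC form with `R = 2λ²pg′/p² + ω²λ²v/p − xη/p`,
`|R| ≤ c(|α| + |β|) + (4/3)|η|/x`, `c = O(x⁻²)`, and `exists_tendsto_pair_of_ftc` applies.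
[cite: ConnesMoscovici2022, Cor 1.7 (ii) and boundary conditions (1.20)–(1.21) (= arXiv:2112.05500 Cor 2.7 (ii), chunk p0006:L121–L123; (2.20)–(2.21), chunk p0006:L62–L69)] -/
theorem exists_asymptotics_atTop_of_ftc_aux (hlam : 0 < lam) {x₀ : ℝ} (hx₀ : 2 * lam ≤ x₀)
    (hx₀1 : 1 ≤ x₀) {g η : ℝ → ℂ} (hg : ContDiffOn ℝ 1 g (Ioi x₀))
    (hftc : ∀ x y, x₀ < x → x ≤ y →
      pCoeff lam y * deriv g y - pCoeff lam x * deriv g x =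
        ∫ t in x..y, (qCoeff lam t * g t - η t))
    (hηm : AEStronglyMeasurable η (volume.restrict (Ioi x₀)))
    (hηL2 : IntegrableOn (fun t ↦ ‖η t‖ ^ 2) (Ioi x₀)) :
    ∃ A B : ℂ,
      Tendsto (fun x : ℝ ↦ (x : ℂ) * g x -
        (A * (Real.sin (2 * π * lam * x) : ℂ) + B * (Real.cos (2 * π * lam * x) : ℂ))) atTop (𝓝 0) ∧
      Tendsto (fun x : ℝ ↦ (g x + (x : ℂ) * deriv g x) -
        ((2 * π * lam : ℝ) : ℂ) * (A * (Real.cos (2 * π * lam * x) : ℂ) -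
          B * (Real.sin (2 * π * lam * x) : ℂ))) atTop (𝓝 0) := by
  set w : ℝ := 2 * π * lam with hw_def
  have hw : 0 < w := by positivity
  have hw0 : w ≠ 0 := hw.ne'
  have hwC : (w : ℂ) ≠ 0 := Complex.ofReal_ne_zero.2 hw0
  set S : Set ℝ := Ioi x₀ with hS
  have hSo : IsOpen S := isOpen_Ioi
  have hx₀0 : 0 < x₀ := lt_of_lt_of_le one_pos hx₀1
  have hSt : ∀ t ∈ S, 2 * lam ≤ t ∧ 1 ≤ t ∧ 0 < t := fun t ht ↦
    ⟨hx₀.trans (le_of_lt ht), hx₀1.trans (le_of_lt ht), hx₀0.trans ht⟩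
  have hp0 : ∀ t ∈ S, pCoeff lam t ≠ 0 := by
    intro t ht h
    have := (norm_pCoeff_bounds hlam (hSt t ht).1).2.1
    rw [h, norm_zero] at this
    nlinarith [(hSt t ht).2.2]
  -- the players
  set u : ℝ → ℂ := fun t ↦ pCoeff lam t * deriv g t with hu
  set f : ℝ → ℂ := fun t ↦ qCoeff lam t * g t - η t with hf
  set v : ℝ → ℂ := fun t ↦ (t : ℂ) * g t with hv
  set v₁ : ℝ → ℂ := fun t ↦ g t + (t : ℂ) * deriv g t with hv₁
  set φ : ℝ → ℂ := fun t ↦ (t : ℂ) / pCoeff lam t with hφ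
  set φ' : ℝ → ℂ := fun t ↦ (((lam ^ 2 + t ^ 2 : ℝ)) : ℂ) / pCoeff lam t ^ 2 with hφ'
  set V₂ : ℝ → ℂ := fun t ↦ u t / pCoeff lam t + φ' t * u t + φ t * f t with hV₂
  set R : ℝ → ℂ := fun t ↦ V₂ t + (w : ℂ) ^ 2 * v t with hR
  -- trigonometric factors
  set sn : ℝ → ℂ := fun t ↦ ((Real.sin (w * t) : ℝ) : ℂ) with hsn
  set cs : ℝ → ℂ := fun t ↦ ((Real.cos (w * t) : ℝ) : ℂ) with hcs
  have hsnc : Continuous sn := Complex.continuous_ofReal.comp (Real.continuous_sin.comp (by fun_prop))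
  have hcsc : Continuous cs := Complex.continuous_ofReal.comp (Real.continuous_cos.comp (by fun_prop))
  have hsnd : ∀ t, HasDerivAt sn ((w : ℂ) * cs t) t := fun t ↦
    (hasDerivAt_sin_ofReal w t).congr_deriv (by simp [hcs])
  have hcsd : ∀ t, HasDerivAt cs (-((w : ℂ) * sn t)) t := fun t ↦
    (hasDerivAt_cos_ofReal w t).congr_deriv (by simp [hsn])
  set α : ℝ → ℂ := fun t ↦ cs t * v t - sn t * v₁ t / w with hα
  set β : ℝ → ℂ := fun t ↦ sn t * v t + cs t * v₁ t / w with hβ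
  set a : ℝ → ℂ := fun t ↦ -(sn t / w) * R t with ha
  set b : ℝ → ℂ := fun t ↦ cs t / w * R t with hb
  -- regularity of `g`
  have hgd : ∀ t ∈ S, HasDerivAt g (deriv g t) t := fun t ht ↦
    ((hg.differentiableOn one_ne_zero t ht).differentiableAt (hSo.mem_nhds ht)).hasDerivAt
  have hg'c : ContinuousOn (deriv g) S := hg.continuousOn_deriv_of_isOpen hSo le_rfl
  have hgc : ContinuousOn g S := hg.continuousOn
  have hpc : Continuous (pCoeff lam) := continuous_pCoeff₂ lam
  have hqc : Continuous (qCoeff lam) := continuous_qCoeff₂ lam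
  have huc : ContinuousOn u S := hpc.continuousOn.mul hg'c
  have hvc : ContinuousOn v S := Complex.continuous_ofReal.continuousOn.mul hgc
  have hv₁c : ContinuousOn v₁ S := hgc.add (Complex.continuous_ofReal.continuousOn.mul hg'c)
  have hφd : ∀ t ∈ S, HasDerivAt φ (φ' t) t := by
    intro t ht
    have h1 : HasDerivAt (fun s : ℝ ↦ (s : ℂ)) 1 t := by simpa using (hasDerivAt_id t).ofReal_comp
    have h := h1.div (hasDerivAt_pCoeff₂ lam t) (hp0 t ht)
    refine h.congr_deriv ?_
    simp only [hφ']
    have : pCoeff lam t = (((lam ^ 2 - t ^ 2 : ℝ)) : ℂ) := rfl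
    rw [this]
    have hne : (((lam ^ 2 - t ^ 2 : ℝ)) : ℂ) ≠ 0 := this ▸ hp0 t ht
    field_simp
    push_cast
    ring
  have hφc : ContinuousOn φ S := fun t ht ↦ (hφd t ht).continuousAt.continuousWithinAt
  have hφ'c : ContinuousOn φ' S := by
    refine ContinuousOn.div (Complex.continuous_ofReal.comp (by fun_prop)).continuousOn
      (hpc.pow 2).continuousOn fun t ht ↦ pow_ne_zero 2 (hp0 t ht)
  -- local integrability of `η` and `f`
  have hηi : ∀ x y, x₀ < x → x ≤ y → IntervalIntegrable η volume x y := by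
    intro x y hx hxy
    have hs : Ioc x y ⊆ S := fun t ht ↦ lt_trans hx ht.1
    rw [intervalIntegrable_iff_integrableOn_Ioc_of_le hxy]
    have hc : IntegrableOn (fun _ : ℝ ↦ (1:ℝ)/2) (Ioc x y) volume :=
      integrableOn_const (measure_Ioc_lt_top (a := x) (b := y)).ne
    refine Integrable.mono' (((hηL2.mono_set hs).div_const 2).add hc) (hηm.mono_set hs)
      (ae_of_all _ fun t ↦ ?_)
    simp only [Pi.add_apply]
    nlinarith [sq_nonneg (‖η t‖ - 1), norm_nonneg (η t)]
  have hfi : ∀ x y, x₀ < x → x ≤ y → IntervalIntegrable f volume x y := by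
    intro x y hx hxy
    have hsub : uIcc x y ⊆ S := by rw [uIcc_of_le hxy]; exact fun t ht ↦ lt_of_lt_of_le hx ht.1
    exact ((hqc.continuousOn.mul (hgc.mono hsub)).intervalIntegrable).sub (hηi x y hx hxy)
  -- FTC for `v₁`: `v₁(y) − v₁(x) = ∫_x^y V₂`
  have hV₂i : ∀ x y, x₀ < x → x ≤ y → IntervalIntegrable V₂ volume x y := by
    intro x y hx hxy
    have hsub : uIcc x y ⊆ S := by rw [uIcc_of_le hxy]; exact fun t ht ↦ lt_of_lt_of_le hx ht.1
    refine (((ContinuousOn.div huc hpc.continuousOn hp0).mono hsub).intervalIntegrable.add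
      (((hφ'c.mul huc).mono hsub).intervalIntegrable)).add ?_
    exact (hfi x y hx hxy).continuousOn_mul (hφc.mono hsub)
  have hv₁F : ∀ x y, x₀ < x → x ≤ y → v₁ y - v₁ x = ∫ t in x..y, V₂ t := by
    intro x y hx hxy
    have hsubI : Icc x y ⊆ S := fun t ht ↦ lt_of_lt_of_le hx ht.1
    have hsub : uIcc x y ⊆ S := by rw [uIcc_of_le hxy]; exact hsubI
    -- `g(y) − g(x) = ∫ u/p`
    have h1 : ∫ t in x..y, u t / pCoeff lam t = g y - g x := by
      rw [intervalIntegral.integral_congr (g := deriv g) fun t ht ↦ by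
        show u t / pCoeff lam t = deriv g t
        rw [hu]; field_simp [hp0 t (hsub ht)]]
      exact intervalIntegral.integral_eq_sub_of_hasDerivAt (fun t ht ↦ hgd t (hsub ht))
        ((hg'c.mono hsub).intervalIntegrable)
    -- `(φ u)(y) − (φ u)(x) = ∫ (φ f + φ′ u)` (integration by parts against the primitive `u`)
    have hIBP := intervalIntegral_mul_eq_of_primitive hxy (f := f) (u := u) (φ := φ) (φ' := φ')
      (hfi x y hx hxy) (fun s hs ↦ by
        have := hftc x s hx hs.1
        simp only [hu]; linear_combination this) (fun s hs ↦ hφd s (hsubI hs)) (hφ'c.mono hsubI)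
    have h2i : IntervalIntegrable (fun t ↦ φ t * f t) volume x y :=
      (hfi x y hx hxy).continuousOn_mul (hφc.mono hsub)
    have h3i : IntervalIntegrable (fun t ↦ φ' t * u t) volume x y :=
      ((hφ'c.mul huc).mono hsub).intervalIntegrable
    have h1i : IntervalIntegrable (fun t ↦ u t / pCoeff lam t) volume x y :=
      ((ContinuousOn.div huc hpc.continuousOn hp0).mono hsub).intervalIntegrable
    have hsplit : ∫ t in x..y, V₂ t =
        (∫ t in x..y, u t / pCoeff lam t) + (∫ t in x..y, φ' t * u t) + ∫ t in x..y, φ t * f t := by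
      rw [← intervalIntegral.integral_add h1i h3i, ← intervalIntegral.integral_add (h1i.add h3i) h2i]
    have hφu : ∀ t ∈ S, φ t * u t = (t : ℂ) * deriv g t := by
      intro t ht; rw [hφ, hu]; field_simp [hp0 t ht]
    rw [hsplit, h1]
    have e1 : v₁ y - v₁ x = (g y - g x) + (φ y * u y - φ x * u x) := by
      simp only [hv₁]
      rw [← hφu y (hsubI (right_mem_Icc.2 hxy)), ← hφu x (hsubI (left_mem_Icc.2 hxy))]; ring
    rw [e1, hIBP]
    ring
  -- `v′ = v₁`
  have hvd : ∀ t ∈ S, HasDerivAt v (v₁ t) t := by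
    intro t ht
    have h1 : HasDerivAt (fun s : ℝ ↦ (s : ℂ)) 1 t := by simpa using (hasDerivAt_id t).ofReal_comp
    exact (h1.mul (hgd t ht)).congr_deriv (by simp [hv₁])
  -- FTC form for `β`: `β(y) − β(x) = ∫_x^y b`
  have hβF : ∀ x y, x₀ < x → x ≤ y → β y - β x = ∫ t in x..y, b t := by
    intro x y hx hxy
    have hsubI : Icc x y ⊆ S := fun t ht ↦ lt_of_lt_of_le hx ht.1
    have hsub : uIcc x y ⊆ S := by rw [uIcc_of_le hxy]; exact hsubI
    -- `[sn v] = ∫ (w cs v + sn v₁)`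
    have i1 : ∫ t in x..y, ((w : ℂ) * cs t * v t + sn t * v₁ t) = sn y * v y - sn x * v x := by
      refine intervalIntegral.integral_eq_sub_of_hasDerivAt (f := fun t ↦ sn t * v t)
        (fun t ht ↦ ?_) ?_
      · exact ((hsnd t).mul (hvd t (hsub ht))).congr_deriv (by ring)
      · exact (((continuous_const.mul hcsc).continuousOn.mul (hvc.mono hsub)).add
          (hsnc.continuousOn.mul (hv₁c.mono hsub))).intervalIntegrable
    -- `[cs/w v₁] = ∫ (cs/w V₂ − sn v₁)` (integration by parts against the primitive `v₁`)
    have i2 := intervalIntegral_mul_eq_of_primitive hxy (f := V₂) (u := v₁)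
      (φ := fun t ↦ cs t / w) (φ' := fun t ↦ -sn t) (hV₂i x y hx hxy)
      (fun s hs ↦ by have := hv₁F x s hx hs.1; linear_combination this)
      (fun s _ ↦ ((hcsd s).div_const (w : ℂ)).congr_deriv (by
        rw [neg_div, mul_div_cancel_left₀ _ hwC]))
      hsnc.neg.continuousOn
    have hi_csv : IntervalIntegrable (fun t ↦ (w : ℂ) * cs t * v t) volume x y :=
      ((continuous_const.mul hcsc).continuousOn.mul (hvc.mono hsub)).intervalIntegrable
    have hi_snv₁ : IntervalIntegrable (fun t ↦ sn t * v₁ t) volume x y :=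
      (hsnc.continuousOn.mul (hv₁c.mono hsub)).intervalIntegrable
    have hi_csV₂ : IntervalIntegrable (fun t ↦ cs t / w * V₂ t) volume x y :=
      (hV₂i x y hx hxy).continuousOn_mul (hcsc.continuousOn.div_const _)
    rw [intervalIntegral.integral_add hi_csv hi_snv₁] at i1
    have e2 : ∫ t in x..y, -sn t * v₁ t = -∫ t in x..y, sn t * v₁ t := by
      rw [← intervalIntegral.integral_neg]; congr 1; funext t; ring
    rw [e2] at i2
    have eb : ∫ t in x..y, b t = (∫ t in x..y, cs t / w * V₂ t) + ∫ t in x..y, (w : ℂ) * cs t * v t := by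
      rw [← intervalIntegral.integral_add hi_csV₂ hi_csv]
      refine intervalIntegral.integral_congr fun t _ ↦ ?_
      simp only [hb, hR]
      exact div_mul_add_sq hwC _ _ _
    rw [eb, i2]
    simp only [hβ]
    linear_combination (-1 : ℂ) * i1
  -- FTC form for `α`: `α(y) − α(x) = ∫_x^y a`
  have hαF : ∀ x y, x₀ < x → x ≤ y → α y - α x = ∫ t in x..y, a t := by
    intro x y hx hxy
    have hsubI : Icc x y ⊆ S := fun t ht ↦ lt_of_lt_of_le hx ht.1
    have hsub : uIcc x y ⊆ S := by rw [uIcc_of_le hxy]; exact hsubI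
    have j1 : ∫ t in x..y, (-((w : ℂ) * sn t) * v t + cs t * v₁ t) = cs y * v y - cs x * v x := by
      refine intervalIntegral.integral_eq_sub_of_hasDerivAt (f := fun t ↦ cs t * v t)
        (fun t ht ↦ ?_) ?_
      · exact ((hcsd t).mul (hvd t (hsub ht))).congr_deriv (by ring)
      · exact (((continuous_const.mul hsnc).neg.continuousOn.mul (hvc.mono hsub)).add
          (hcsc.continuousOn.mul (hv₁c.mono hsub))).intervalIntegrable
    have j2 := intervalIntegral_mul_eq_of_primitive hxy (f := V₂) (u := v₁)
      (φ := fun t ↦ sn t / w) (φ' := fun t ↦ cs t) (hV₂i x y hx hxy)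
      (fun s hs ↦ by have := hv₁F x s hx hs.1; linear_combination this)
      (fun s _ ↦ ((hsnd s).div_const (w : ℂ)).congr_deriv (by
        rw [mul_div_cancel_left₀ _ hwC]))
      hcsc.continuousOn
    have hj_snv : IntervalIntegrable (fun t ↦ -((w : ℂ) * sn t) * v t) volume x y :=
      ((continuous_const.mul hsnc).neg.continuousOn.mul (hvc.mono hsub)).intervalIntegrable
    have hj_csv₁ : IntervalIntegrable (fun t ↦ cs t * v₁ t) volume x y :=
      (hcsc.continuousOn.mul (hv₁c.mono hsub)).intervalIntegrable
    have hj_snV₂ : IntervalIntegrable (fun t ↦ sn t / w * V₂ t) volume x y :=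
      (hV₂i x y hx hxy).continuousOn_mul (hsnc.continuousOn.div_const _)
    rw [intervalIntegral.integral_add hj_snv hj_csv₁] at j1
    have hj' : IntervalIntegrable (fun t ↦ -(sn t / w * V₂ t)) volume x y := hj_snV₂.neg
    have ea : ∫ t in x..y, a t = -(∫ t in x..y, sn t / w * V₂ t) + ∫ t in x..y, -((w : ℂ) * sn t) * v t := by
      rw [← intervalIntegral.integral_neg, ← intervalIntegral.integral_add hj' hj_snv]
      refine intervalIntegral.integral_congr fun t _ ↦ ?_
      simp only [ha, hR]
      have := div_mul_add_sq hwC (sn t) (V₂ t) (v t)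
      linear_combination (-1 : ℂ) * this
    rw [ea, j2]
    simp only [hα]
    linear_combination (-1 : ℂ) * j1
  -- the forcing `R = 2λ² u/p² + ω²λ² v/p − tη/p` and its bound
  have hRid : ∀ t ∈ S, R t = ((2 * lam ^ 2 : ℝ) : ℂ) * u t / pCoeff lam t ^ 2 +
      ((w ^ 2 * lam ^ 2 : ℝ) : ℂ) * v t / pCoeff lam t - (t : ℂ) * η t / pCoeff lam t := by
    intro t ht
    have hp : pCoeff lam t = (((lam ^ 2 - t ^ 2 : ℝ)) : ℂ) := rfl
    have hq : qCoeff lam t = (((w ^ 2 * t ^ 2 : ℝ)) : ℂ) := by simp [qCoeff, hw_def]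
    have hne : (((lam ^ 2 - t ^ 2 : ℝ)) : ℂ) ≠ 0 := hp ▸ hp0 t ht
    simp only [hR, hV₂, hφ, hφ', hf, hv, hp, hq]
    field_simp
    push_cast
    ring
  have hu_le : ∀ t ∈ S, ‖u t‖ ≤ t * (‖v₁ t‖ + ‖v t‖) := by
    intro t ht
    obtain ⟨h2l, ht1, ht0⟩ := hSt t ht
    obtain ⟨-, -, hPle⟩ := norm_pCoeff_bounds hlam h2l
    have htC : (t : ℂ) ≠ 0 := Complex.ofReal_ne_zero.2 ht0.ne'
    have hdg : deriv g t = (v₁ t - v t / t) / t := by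
      simp only [hv₁, hv]; field_simp; ring
    have h1 : ‖deriv g t‖ ≤ (‖v₁ t‖ + ‖v t‖) / t := by
      rw [hdg, norm_div, Complex.norm_real, Real.norm_of_nonneg ht0.le]
      gcongr
      refine (norm_sub_le _ _).trans (add_le_add le_rfl ?_)
      rw [norm_div, Complex.norm_real, Real.norm_of_nonneg ht0.le]
      exact div_le_self (norm_nonneg _) ht1
    calc ‖u t‖ = ‖pCoeff lam t‖ * ‖deriv g t‖ := norm_mul _ _
      _ ≤ t ^ 2 * ((‖v₁ t‖ + ‖v t‖) / t) := by gcongr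
      _ = t * (‖v₁ t‖ + ‖v t‖) := by field_simp
  set K₀ : ℝ := 32 * lam ^ 2 / 9 + 4 / 3 * (w ^ 2 * lam ^ 2) with hK₀
  have hK₀0 : 0 ≤ K₀ := by positivity
  have hR_le : ∀ t ∈ S, ‖R t‖ ≤ K₀ * (‖v t‖ + ‖v₁ t‖) * (t ^ 2)⁻¹ +
      2 / 3 * (‖η t‖ ^ 2 + (t ^ 2)⁻¹) := by
    intro t ht
    obtain ⟨h2l, ht1, ht0⟩ := hSt t ht
    obtain ⟨-, hPge, hPle⟩ := norm_pCoeff_bounds hlam h2l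
    have hP0 : 0 < ‖pCoeff lam t‖ := lt_of_lt_of_le (by positivity) hPge
    set X : ℝ := ‖v t‖ + ‖v₁ t‖ with hX
    have hX0 : 0 ≤ X := by positivity
    have hT1 : ‖((2 * lam ^ 2 : ℝ) : ℂ) * u t / pCoeff lam t ^ 2‖ ≤ 32 * lam ^ 2 / 9 * X * (t ^ 2)⁻¹ := by
      rw [norm_div, norm_mul, norm_pow, Complex.norm_real, Real.norm_of_nonneg (by positivity)]
      calc 2 * lam ^ 2 * ‖u t‖ / ‖pCoeff lam t‖ ^ 2
          ≤ 2 * lam ^ 2 * (t * X) / (3 / 4 * t ^ 2) ^ 2 := by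
            gcongr
            · rw [hX, add_comm]; exact hu_le t ht
        _ = 32 * lam ^ 2 / 9 * X / t ^ 3 := by field_simp; ring
        _ ≤ 32 * lam ^ 2 / 9 * X / t ^ 2 := by
            refine div_le_div_of_nonneg_left (by positivity) (by positivity) ?_
            exact pow_le_pow_right₀ ht1 (by norm_num)
        _ = 32 * lam ^ 2 / 9 * X * (t ^ 2)⁻¹ := by rw [div_eq_mul_inv]
    have hT2 : ‖((w ^ 2 * lam ^ 2 : ℝ) : ℂ) * v t / pCoeff lam t‖ ≤
        4 / 3 * (w ^ 2 * lam ^ 2) * X * (t ^ 2)⁻¹ := by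
      rw [norm_div, norm_mul, Complex.norm_real, Real.norm_of_nonneg (by positivity)]
      calc w ^ 2 * lam ^ 2 * ‖v t‖ / ‖pCoeff lam t‖
          ≤ w ^ 2 * lam ^ 2 * X / (3 / 4 * t ^ 2) := by
            gcongr
            · rw [hX]; linarith [norm_nonneg (v₁ t)]
        _ = 4 / 3 * (w ^ 2 * lam ^ 2) * X * (t ^ 2)⁻¹ := by field_simp
    have hT3 : ‖(t : ℂ) * η t / pCoeff lam t‖ ≤ 2 / 3 * (‖η t‖ ^ 2 + (t ^ 2)⁻¹) := by
      rw [norm_div, norm_mul, Complex.norm_real, Real.norm_of_nonneg ht0.le]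
      have h1 : t * ‖η t‖ / ‖pCoeff lam t‖ ≤ t * ‖η t‖ / (3 / 4 * t ^ 2) := by
        gcongr
      have h2 : t * ‖η t‖ / (3 / 4 * t ^ 2) = 4 / 3 * (‖η t‖ * t⁻¹) := by field_simp
      have h3 : ‖η t‖ * t⁻¹ ≤ (‖η t‖ ^ 2 + (t ^ 2)⁻¹) / 2 := by
        rw [← inv_pow]
        nlinarith [sq_nonneg (‖η t‖ - t⁻¹), norm_nonneg (η t), inv_pos.2 ht0]
      calc t * ‖η t‖ / ‖pCoeff lam t‖ ≤ 4 / 3 * (‖η t‖ * t⁻¹) := h1.trans_eq h2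
        _ ≤ 4 / 3 * ((‖η t‖ ^ 2 + (t ^ 2)⁻¹) / 2) := by gcongr
        _ = 2 / 3 * (‖η t‖ ^ 2 + (t ^ 2)⁻¹) := by ring
    rw [hRid t ht]
    calc ‖((2 * lam ^ 2 : ℝ) : ℂ) * u t / pCoeff lam t ^ 2 +
          ((w ^ 2 * lam ^ 2 : ℝ) : ℂ) * v t / pCoeff lam t - (t : ℂ) * η t / pCoeff lam t‖
        ≤ ‖((2 * lam ^ 2 : ℝ) : ℂ) * u t / pCoeff lam t ^ 2‖ +
          ‖((w ^ 2 * lam ^ 2 : ℝ) : ℂ) * v t / pCoeff lam t‖ + ‖(t : ℂ) * η t / pCoeff lam t‖ :=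
          (norm_sub_le _ _).trans (add_le_add (norm_add_le _ _) le_rfl)
      _ ≤ 32 * lam ^ 2 / 9 * X * (t ^ 2)⁻¹ + 4 / 3 * (w ^ 2 * lam ^ 2) * X * (t ^ 2)⁻¹ +
          2 / 3 * (‖η t‖ ^ 2 + (t ^ 2)⁻¹) := add_le_add (add_le_add hT1 hT2) hT3
      _ = K₀ * X * (t ^ 2)⁻¹ + 2 / 3 * (‖η t‖ ^ 2 + (t ^ 2)⁻¹) := by rw [hK₀]; ring
  -- the majorants `c`, `h`
  set K₁ : ℝ := K₀ * (1 + w) / w with hK₁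
  have hK₁0 : 0 ≤ K₁ := by positivity
  set c : ℝ → ℝ := fun t ↦ K₁ * (t ^ 2)⁻¹ with hc
  set hh : ℝ → ℝ := fun t ↦ 2 / (3 * w) * (‖η t‖ ^ 2 + (t ^ 2)⁻¹) with hhh
  have hinv_int : IntegrableOn (fun t : ℝ ↦ (t ^ 2)⁻¹) S := by
    refine ((integrableOn_Ioi_rpow_of_lt (by norm_num : (-2:ℝ) < -1) hx₀0).congr_fun
      (fun t ht ↦ ?_) measurableSet_Ioi)
    show t ^ (-2 : ℝ) = (t ^ 2)⁻¹
    rw [Real.rpow_neg (le_of_lt (hx₀0.trans ht)), Real.rpow_two]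
  have hcint : IntegrableOn c S := hinv_int.const_mul K₁
  have hhint : IntegrableOn hh S := (hηL2.add hinv_int).const_mul _
  have hc0 : ∀ t ∈ S, 0 ≤ c t := fun t ht ↦ by simp only [hc]; positivity
  have hh0 : ∀ t ∈ S, 0 ≤ hh t := fun t ht ↦ by simp only [hhh]; positivity
  -- `‖v‖ + ‖v₁‖ ≤ (1 + w)(‖α‖ + ‖β‖)`
  have hvv₁ : ∀ t, ‖v t‖ + ‖v₁ t‖ ≤ (1 + w) * (‖α t‖ + ‖β t‖) := by
    intro t
    have ha' := norm_le_osc hw0 (w * t) (v t) (v₁ t)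
    have hb' := norm_deriv_le_osc hw0 (w * t) (v t) (v₁ t)
    rw [abs_of_pos hw] at hb'
    simp only [hα, hβ, hsn, hcs]
    linarith
  have hab_le : ∀ {ψ : ℝ → ℂ} {trig : ℝ → ℂ}, (∀ t, ‖trig t * R t‖ ≤ ‖R t‖) →
      (∀ t, ψ t = trig t / w * R t ∨ ψ t = -(trig t / w) * R t) →
      ∀ t ∈ S, ‖ψ t‖ ≤ c t * (‖α t‖ + ‖β t‖) + hh t := by
    intro ψ trig htrig hψ t ht
    have h1 : ‖ψ t‖ ≤ ‖R t‖ / w := by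
      have e : ‖ψ t‖ = ‖trig t * R t‖ / w := by
        rcases hψ t with h | h
        · rw [h, div_mul_eq_mul_div, norm_div, Complex.norm_real, Real.norm_of_nonneg hw.le]
        · rw [h, neg_mul, norm_neg, div_mul_eq_mul_div, norm_div, Complex.norm_real,
            Real.norm_of_nonneg hw.le]
      rw [e]
      exact div_le_div_of_nonneg_right (htrig t) hw.le
    refine h1.trans ?_
    rw [div_le_iff₀ hw]
    have h2 := hR_le t ht
    have h3 := hvv₁ t
    have hct : c t * (‖α t‖ + ‖β t‖) * w = K₀ * ((1 + w) * (‖α t‖ + ‖β t‖)) * (t ^ 2)⁻¹ := by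
      simp only [hc, hK₁]; field_simp
    have hht : hh t * w = 2 / 3 * (‖η t‖ ^ 2 + (t ^ 2)⁻¹) := by
      simp only [hhh]; field_simp
    have hi0 : 0 ≤ (t ^ 2)⁻¹ := by positivity
    calc ‖R t‖ ≤ K₀ * (‖v t‖ + ‖v₁ t‖) * (t ^ 2)⁻¹ + 2 / 3 * (‖η t‖ ^ 2 + (t ^ 2)⁻¹) := h2
      _ ≤ K₀ * ((1 + w) * (‖α t‖ + ‖β t‖)) * (t ^ 2)⁻¹ + 2 / 3 * (‖η t‖ ^ 2 + (t ^ 2)⁻¹) := by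
          gcongr
      _ = (c t * (‖α t‖ + ‖β t‖) + hh t) * w := by
          rw [add_mul (c t * (‖α t‖ + ‖β t‖)) (hh t) w, hct, hht]
  have hale : ∀ t ∈ S, ‖a t‖ ≤ c t * (‖α t‖ + ‖β t‖) + hh t :=
    hab_le (trig := sn) (fun t ↦ norm_sin_mul_le _ _) (fun t ↦ Or.inr rfl)
  have hble : ∀ t ∈ S, ‖b t‖ ≤ c t * (‖α t‖ + ‖β t‖) + hh t :=
    hab_le (trig := cs) (fun t ↦ norm_cos_mul_le _ _) (fun t ↦ Or.inl rfl)
  -- measurability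
  have mS : MeasurableSet S := measurableSet_Ioi
  have hfm : AEStronglyMeasurable f (volume.restrict S) :=
    ((hqc.continuousOn.mul hgc).aestronglyMeasurable mS).sub hηm
  have hV₂m : AEStronglyMeasurable V₂ (volume.restrict S) :=
    ((((huc.div hpc.continuousOn hp0).aestronglyMeasurable mS).add
      ((hφ'c.mul huc).aestronglyMeasurable mS)).add ((hφc.aestronglyMeasurable mS).mul hfm))
  have hRm : AEStronglyMeasurable R (volume.restrict S) :=
    hV₂m.add ((hvc.aestronglyMeasurable mS).const_mul _)
  have ham : AEStronglyMeasurable a (volume.restrict S) :=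
    ((hsnc.div_const (w : ℂ)).neg.aestronglyMeasurable).mul hRm
  have hbm : AEStronglyMeasurable b (volume.restrict S) :=
    ((hcsc.div_const (w : ℂ)).aestronglyMeasurable).mul hRm
  -- continuity of `α`, `β`
  have hαc : ContinuousOn α S :=
    (hcsc.continuousOn.mul hvc).sub ((hsnc.continuousOn.mul hv₁c).div_const _)
  have hβc : ContinuousOn β S :=
    (hsnc.continuousOn.mul hvc).add ((hcsc.continuousOn.mul hv₁c).div_const _)
  -- the abstract lemma
  obtain ⟨⟨Bc, hBc⟩, ⟨Ac, hAc⟩⟩ := exists_tendsto_pair_of_ftc hαc hβc hαF hβF ham hbm hc0 hcint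
    hh0 hhint hale hble
  refine ⟨Ac, Bc, ?_, ?_⟩
  · have hα0 : Tendsto (fun x ↦ ‖α x - Bc‖) atTop (𝓝 0) := tendsto_iff_norm_sub_tendsto_zero.mp hBc
    have hβ0 : Tendsto (fun x ↦ ‖β x - Ac‖) atTop (𝓝 0) := tendsto_iff_norm_sub_tendsto_zero.mp hAc
    have h1 : Tendsto (fun x ↦ cs x * (α x - Bc) + sn x * (β x - Ac)) atTop (𝓝 0) := by
      have := (squeeze_zero_norm (fun x ↦ norm_cos_mul_le (w * x) (α x - Bc)) hα0).add
        (squeeze_zero_norm (fun x ↦ norm_sin_mul_le (w * x) (β x - Ac)) hβ0)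
      rw [add_zero] at this
      exact this
    refine h1.congr' ?_
    filter_upwards [eventually_gt_atTop x₀] with x hx
    have hrec := osc_reconstruct hw0 (w * x) (v x) (v₁ x)
    simp only [hα, hβ, hsn, hcs, hv] at hrec ⊢
    linear_combination hrec
  · have hα0 : Tendsto (fun x ↦ ‖α x - Bc‖) atTop (𝓝 0) := tendsto_iff_norm_sub_tendsto_zero.mp hBc
    have hβ0 : Tendsto (fun x ↦ ‖β x - Ac‖) atTop (𝓝 0) := tendsto_iff_norm_sub_tendsto_zero.mp hAc
    have h1 : Tendsto (fun x ↦ (w : ℂ) * (cs x * (β x - Ac) - sn x * (α x - Bc))) atTop (𝓝 0) := by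
      have := ((squeeze_zero_norm (fun x ↦ norm_cos_mul_le (w * x) (β x - Ac)) hβ0).sub
        (squeeze_zero_norm (fun x ↦ norm_sin_mul_le (w * x) (α x - Bc)) hα0)).const_mul (w : ℂ)
      rw [sub_zero, mul_zero] at this
      exact this
    refine h1.congr' ?_
    filter_upwards [eventually_gt_atTop x₀] with x hx
    have hrec := osc_reconstruct_deriv hw0 (w * x) (v x) (v₁ x)
    simp only [hα, hβ, hsn, hcs, hv, hv₁] at hrec ⊢
    linear_combination hrec

/-- **Asymptotics at `+∞` of a general solution of the prolate equation in FTC form (no boundary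
condition assumed).**  Let `g ∈ C¹(x₀, ∞)` (any `x₀`) with `p g′` a primitive of `q g − η` on
`(x₀, ∞)` — the shape of `UVProlateMaxDomainRegularity.exists_regular_repr` for `ξ ∈ dom W_max`,
`η = W_max ξ`, restricted to the right component — and `η ∈ L²(x₀, ∞)` (no hypothesis on `g`
beyond `C¹`: square-integrability of `g` is not needed).  Then for some `A, B ∈ ℂ`
`x g(x) − (A sin(2πλx) + B cos(2πλx)) → 0` and `(g + x g′)(x) − 2πλ (A cos(2πλx) − B sin(2πλx)) → 0`
as `x → +∞`: every element of `dom W_max` oscillates like `(A sin + B cos)(2πλx)/x` at `+∞`, the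
printed "leading term of the asymptotic expansion … proportional to `sin(2πλx)/x` (even) /
`cos(2πλx)/x` (odd)" being the case selected by the boundary conditions (1.20)/(1.21)
(`tendsto_bcInfEven_of_asymptotics` / `tendsto_bcInfOdd_of_asymptotics`).  Mechanism: osculating
constants `α = cos(ωx)v − sin(ωx)v₁/ω`, `β = sin(ωx)v + cos(ωx)v₁/ω` (`v = xg`, `v₁ = g + xg′`,
`ω = 2πλ`) in FTC form via integration by parts against the primitive `p g′`
(`intervalIntegral_mul_eq_of_primitive`), forcing `R = 2λ²pg′/p² + ω²λ²v/p − xη/p` with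
`|R| ≤ c(|α| + |β|) + (2/3)(|η|² + x⁻²)`, `c = O(x⁻²)`, and `exists_tendsto_pair_of_ftc`.
[cite: ConnesMoscovici2022, Cor 1.7 (ii) and boundary conditions (1.20)–(1.21) (= arXiv:2112.05500 Cor 2.7 (ii), chunk p0006:L121–L123; (2.20)–(2.21), chunk p0006:L62–L69)] -/
theorem exists_asymptotics_atTop_of_ftc (hlam : 0 < lam) {x₀ : ℝ}
    {g η : ℝ → ℂ} (hg : ContDiffOn ℝ 1 g (Ioi x₀))
    (hftc : ∀ x y, x₀ < x → x ≤ y →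
      pCoeff lam y * deriv g y - pCoeff lam x * deriv g x =
        ∫ t in x..y, (qCoeff lam t * g t - η t))
    (hηm : AEStronglyMeasurable η (volume.restrict (Ioi x₀)))
    (hηL2 : IntegrableOn (fun t ↦ ‖η t‖ ^ 2) (Ioi x₀)) :
    ∃ A B : ℂ,
      Tendsto (fun x : ℝ ↦ (x : ℂ) * g x -
        (A * (Real.sin (2 * π * lam * x) : ℂ) + B * (Real.cos (2 * π * lam * x) : ℂ))) atTop (𝓝 0) ∧
      Tendsto (fun x : ℝ ↦ (g x + (x : ℂ) * deriv g x) -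
        ((2 * π * lam : ℝ) : ℂ) * (A * (Real.cos (2 * π * lam * x) : ℂ) -
          B * (Real.sin (2 * π * lam * x) : ℂ))) atTop (𝓝 0) := by
  set x₁ : ℝ := max (2 * lam) (max 1 x₀) with hx₁
  have h2l : 2 * lam ≤ x₁ := le_max_left _ _
  have h1 : 1 ≤ x₁ := (le_max_left _ _).trans (le_max_right _ _)
  have h0 : x₀ ≤ x₁ := (le_max_right _ _).trans (le_max_right _ _)
  have hsub : Ioi x₁ ⊆ Ioi x₀ := Ioi_subset_Ioi h0
  exact exists_asymptotics_atTop_of_ftc_aux hlam h2l h1 (hg.mono hsub)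
    (fun x y hx hxy ↦ hftc x y (lt_of_le_of_lt h0 hx) hxy) (hηm.mono_set hsub) (hηL2.mono_set hsub)

end Prolate

/-! ## §4. The boundary expressions (1.20)/(1.21) along the asymptotics -/

section BoundaryExpressions

variable {lam : ℝ}

/-- **The even boundary expression (1.20) along the asymptotics**: if `x g − (A sin + B cos)(2πλx) → 0`
and `(g + x g′) − 2πλ(A cos − B sin)(2πλx) → 0`, then
`bcInfEven λ g (x) = x sin(2πλx) g′ − (2πλx cos(2πλx) − sin(2πλx)) g → −2πλ·B`; so for such `g`
the boundary condition (1.20) at `+∞` holds iff `B = 0` (the `cos(2πλx)/x` component vanishes —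
"the leading term … is proportional to `sin(2πλx)/x` if `φ` is even").
[cite: ConnesMoscovici2022, §1 boundary condition (1.20) and Cor 1.7 (ii) (= arXiv:2112.05500 (2.20), chunk p0006:L64–L66; Cor 2.7 (ii), L121–L123)] -/
theorem tendsto_bcInfEven_of_asymptotics (lam : ℝ) {g : ℝ → ℂ} {A B : ℂ}
    (h1 : Tendsto (fun x : ℝ ↦ (x : ℂ) * g x -
      (A * (Real.sin (2 * π * lam * x) : ℂ) + B * (Real.cos (2 * π * lam * x) : ℂ))) atTop (𝓝 0))
    (h2 : Tendsto (fun x : ℝ ↦ (g x + (x : ℂ) * deriv g x) -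
      ((2 * π * lam : ℝ) : ℂ) * (A * (Real.cos (2 * π * lam * x) : ℂ) -
        B * (Real.sin (2 * π * lam * x) : ℂ))) atTop (𝓝 0)) :
    Tendsto (bcInfEven lam g) atTop (𝓝 (-(((2 * π * lam : ℝ) : ℂ) * B))) := by
  have hE₁ : Tendsto (fun x : ℝ ↦ ((2 * π * lam : ℝ) : ℂ) * (((Real.cos (2 * π * lam * x) : ℝ) : ℂ) *
      ((x : ℂ) * g x - (A * (Real.sin (2 * π * lam * x) : ℂ) + B * (Real.cos (2 * π * lam * x) : ℂ)))))
      atTop (𝓝 0) := by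
    have := (squeeze_zero_norm (fun x : ℝ ↦ norm_cos_mul_le (2 * π * lam * x)
      ((x : ℂ) * g x - (A * (Real.sin (2 * π * lam * x) : ℂ) + B * (Real.cos (2 * π * lam * x) : ℂ))))
      (tendsto_zero_iff_norm_tendsto_zero.mp h1)).const_mul ((2 * π * lam : ℝ) : ℂ)
    rw [mul_zero] at this
    exact this
  have hE₂ : Tendsto (fun x : ℝ ↦ ((Real.sin (2 * π * lam * x) : ℝ) : ℂ) *
      ((g x + (x : ℂ) * deriv g x) - ((2 * π * lam : ℝ) : ℂ) * (A * (Real.cos (2 * π * lam * x) : ℂ) -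
        B * (Real.sin (2 * π * lam * x) : ℂ)))) atTop (𝓝 0) :=
    squeeze_zero_norm (fun x : ℝ ↦ norm_sin_mul_le (2 * π * lam * x) _)
      (tendsto_zero_iff_norm_tendsto_zero.mp h2)
  have hlim := (tendsto_const_nhds (x := -(((2 * π * lam : ℝ) : ℂ) * B))).add (hE₂.sub hE₁)
  rw [sub_zero, add_zero] at hlim
  refine hlim.congr' (Eventually.of_forall fun x ↦ ?_)
  simp only [bcInfEven]
  push_cast
  have h := Complex.cos_sq_add_sin_sq (2 * (π : ℂ) * (lam : ℂ) * (x : ℂ))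
  linear_combination (2 * (π : ℂ) * (lam : ℂ) * B) * h

/-- **The odd boundary expression (1.21) along the asymptotics**:
`bcInfOdd λ g (x) = x cos(2πλx) g′ + (2πλx sin(2πλx) + cos(2πλx)) g → 2πλ·A`; so (1.21) at `+∞`
holds iff `A = 0` (the `sin(2πλx)/x` component vanishes — "proportional to `cos(2πλx)/x` if `φ`
is odd").
[cite: ConnesMoscovici2022, §1 boundary condition (1.21) and Cor 1.7 (ii) (= arXiv:2112.05500 (2.21), chunk p0006:L67–L69; Cor 2.7 (ii), L121–L123)] -/
theorem tendsto_bcInfOdd_of_asymptotics (lam : ℝ) {g : ℝ → ℂ} {A B : ℂ}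
    (h1 : Tendsto (fun x : ℝ ↦ (x : ℂ) * g x -
      (A * (Real.sin (2 * π * lam * x) : ℂ) + B * (Real.cos (2 * π * lam * x) : ℂ))) atTop (𝓝 0))
    (h2 : Tendsto (fun x : ℝ ↦ (g x + (x : ℂ) * deriv g x) -
      ((2 * π * lam : ℝ) : ℂ) * (A * (Real.cos (2 * π * lam * x) : ℂ) -
        B * (Real.sin (2 * π * lam * x) : ℂ))) atTop (𝓝 0)) :
    Tendsto (bcInfOdd lam g) atTop (𝓝 (((2 * π * lam : ℝ) : ℂ) * A)) := by
  have hE₁ : Tendsto (fun x : ℝ ↦ ((2 * π * lam : ℝ) : ℂ) * (((Real.sin (2 * π * lam * x) : ℝ) : ℂ) *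
      ((x : ℂ) * g x - (A * (Real.sin (2 * π * lam * x) : ℂ) + B * (Real.cos (2 * π * lam * x) : ℂ)))))
      atTop (𝓝 0) := by
    have := (squeeze_zero_norm (fun x : ℝ ↦ norm_sin_mul_le (2 * π * lam * x)
      ((x : ℂ) * g x - (A * (Real.sin (2 * π * lam * x) : ℂ) + B * (Real.cos (2 * π * lam * x) : ℂ))))
      (tendsto_zero_iff_norm_tendsto_zero.mp h1)).const_mul ((2 * π * lam : ℝ) : ℂ)
    rw [mul_zero] at this
    exact this
  have hE₂ : Tendsto (fun x : ℝ ↦ ((Real.cos (2 * π * lam * x) : ℝ) : ℂ) *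
      ((g x + (x : ℂ) * deriv g x) - ((2 * π * lam : ℝ) : ℂ) * (A * (Real.cos (2 * π * lam * x) : ℂ) -
        B * (Real.sin (2 * π * lam * x) : ℂ)))) atTop (𝓝 0) :=
    squeeze_zero_norm (fun x : ℝ ↦ norm_cos_mul_le (2 * π * lam * x) _)
      (tendsto_zero_iff_norm_tendsto_zero.mp h2)
  have hlim := (tendsto_const_nhds (x := ((2 * π * lam : ℝ) : ℂ) * A)).add (hE₂.add hE₁)
  rw [add_zero, add_zero] at hlim
  refine hlim.congr' (Eventually.of_forall fun x ↦ ?_)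
  simp only [bcInfOdd]
  push_cast
  have h := Complex.cos_sq_add_sin_sq (2 * (π : ℂ) * (lam : ℂ) * (x : ℂ))
  linear_combination (-(2 * (π : ℂ) * (lam : ℂ)) * A) * h

end BoundaryExpressions

end Literature.NumberTheory.ConnesMoscovici2022

end
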